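import Literature.NumberTheory.NumberFields.ClassGroupPTorsionFixedFieldDescent
import Literature.NumberTheory.IwasawaTheory.FukudaRankCountingLemmas
import Mathlib.GroupTheory.PGroup
import HarnessLib

/-!
# Class groups in a Galois extension of prime-power degree `ℓ^a` prime to `p`:
# `#Cl(L)[p^k]^{Gal} = #Cl(K)[p^k]`, `p^{ord_p h_L} ≡ p^{ord_p h_K} (mod ℓ)`, `p^{rank_p Cl(L)} ≡ p^{rank_p Cl(K)} (mod ℓ)`;
# for a cubic Galois extension: `ord₂ h_L ≡ ord₂ h_K` and `rank₂ Cl(L) ≡ rank₂ Cl(K) (mod 2)`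

Topic `NumberTheory/NumberFields` (namespace = path).  THEOREM-ONLY file (no definition, no named fact, no `sorry`), written by the
prover seat `bsd-line-att-p3` g29 (cell `bsd-f1-sign2`, route `AlignedTransportAtTwo`, crux C2 stmt-BirchSwinnertonDyer-22298: the sextic
`ℚ(W[2])` is a Galois CUBIC extension of the resolvent field `ℚ(√Δ_W)`; closes nothing; BSD is proved for no curve here).

THE OBSERVATION.  Let `L/K` be a finite Galois extension of number fields whose group `G` is an `ℓ`-group (`[L : K] = ℓ^a`) and let
`p ≠ ℓ` be a prime.  (1) For every `k`, the `G`-fixed `p^k`-torsion classes of `L` are exactly as many as the `p^k`-torsion classes of `K`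
(`i_{L/K}` and `N_{L/K}` are mutually inverse up to the automorphism `c ↦ c^{[L:K]}` of the `p`-power torsion: Neukirch III (1.6) (ii) `N ∘ i =
(·)^{[L:K]}`, (iv) `i ∘ N = ∏_{σ ∈ G} σ` — the tree's `natCard_fixed_torsion_classGroup_eq_natCard_torsion_classGroup_fixedField` is the case `k = 1`).
(2) `G` permutes the finite set `Cl(L)[p^k]` and `G` is an `ℓ`-group, so `#Cl(L)[p^k] ≡ #Cl(L)[p^k]^G (mod ℓ)` (orbits have `ℓ`-power size;
Mathlib `IsPGroup.card_modEq_card_fixedPoints`).  With `k` large (resp. `k = 1`) both counts are powers of `p`, whence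

  `p^{ord_p h(L)} ≡ p^{ord_p h(K)} (mod ℓ)`  and  `p^{rank_p Cl(L)} ≡ p^{rank_p Cl(K)} (mod ℓ)`,

i.e. `ord_p h(L) − ord_p h(K)` and `rank_p Cl(L) − rank_p Cl(K)` (both `≥ 0`) are multiples of the order of `p` modulo `ℓ`.  When
`p ≡ −1 (mod ℓ)`, `ℓ > 2` — in particular for `ℓ = 3`, `p = 2` — this is a PARITY law: `ord₂ h(L) ≡ ord₂ h(K) (mod 2)` and
`rank₂ Cl(L) ≡ rank₂ Cl(K) (mod 2)` for every Galois cubic extension `L/K`.  This is the numerical shadow of the semisimple decomposition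
`A_L = A_K ⊕ (1 − e_G)A_L` of the `p`-class group over `ℤ_p[G]` (the complement is a module over `ℤ_p[ζ_ℓ]`-type orders, whose finite modules
have order a power of `p^f`): Washington, *Introduction to Cyclotomic Fields*, §10.1 (before Thm. 10.1: `p ∤ [L:K]` ⇒ `A_K → A_L^G` is an
isomorphism) and Thm. 10.8 («Let `L/K` be a cyclic extension of degree `n` … `p ∤ n` … then the `p`-rank of `A_L` is a multiple of `f`», there
under the hypothesis that the intermediate class numbers are prime to `p`; here in the relative form, with no hypothesis on `h_K`, by orbit
counting instead of representation theory).

* §0 `modEq_two_of_pow_modEq_of_natCast_eq_neg_one` — `p ≡ −1 (mod ℓ)`, `2 < ℓ`, `p^a ≡ p^b (mod ℓ)` ⟹ `a ≡ b (mod 2)`.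
* §1 counting in a finite commutative group `M`: `natCard_torsion_pow_eq_pow_padicValNat` (`#M[p^k] = p^{v_p #M}` for `k ≥ v_p #M`),
  `natCard_torsion_eq_pow_padicValNat_card_quotient` (`#M[p] = p^{v_p #(M/M^p)}`), `natCard_torsion_modEq_natCard_fixed_torsion`
  (an `ℓ`-group acting by automorphisms: `#M[q] ≡ #M[q]^G (mod ℓ)`).
* §2 number fields, `L/K` Galois: `natCard_fixed_torsion_pow_classGroup_eq` (**`#Cl(L)[p^k]^G = #Cl(K)[p^k]`**, `p ∤ [L:K]`);
  `padicValNat_card_classGroup_le_of_not_dvd_finrank` (`v_p h_K ≤ v_p h_L`), `padicValNat_card_quotient_pow_le_of_not_dvd_finrank`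
  (`rank_p Cl(K) ≤ rank_p Cl(L)`); `natCard_torsion_classGroup_modEq_fixed` (`#Cl(L)[q] ≡ #Cl(L)[q]^G (mod ℓ)` for `G` an `ℓ`-group);
  ★ `pow_padicValNat_card_classGroup_modEq` (**`p^{v_p h_L} ≡ p^{v_p h_K} (mod ℓ)`**), ★ `pow_padicValNat_card_quotient_pow_modEq`
  (**`p^{rank_p Cl(L)} ≡ p^{rank_p Cl(K)} (mod ℓ)**`).
* §3 parity: `padicValNat_card_classGroup_modEq_two` / `padicValNat_card_quotient_pow_modEq_two` (`p ≡ −1 (mod ℓ)`, `2 < ℓ`); the cubic case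
  ★ `padicValNat_two_card_classGroup_modEq_two_of_finrank_dvd_three` (**`ord₂ h_L ≡ ord₂ h_K (mod 2)`**),
  ★ `padicValNat_two_card_quotient_sq_modEq_two_of_finrank_dvd_three` (**`rank₂ Cl(L) ≡ rank₂ Cl(K) (mod 2)**`), and the
  `Even (· − ·)` forms, for `[L : K] ∣ 3`.

References: [Washington1997] L. C. Washington, *Introduction to Cyclotomic Fields*, 2nd ed., GTM 83 (1997), §10.1 (`p ∤ [L:K]`: `A_K ≅ A_L^G`)
and Thm. 10.8; [NeukirchANT1999] J. Neukirch, *Algebraic Number Theory* (1999), Ch. III §1 Prop. (1.6) (ii), (iv); tree: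
`ClassGroupPTorsionFixedFieldDescent` (the case `k = 1` over a fixed field), `ClassGroupNormGalois` (`i ∘ N = ∏ σ`), `ClassGroupExtension`
(`N ∘ i = (·)^{[L:K]}`, `classGroupExtend_injOn_pow_eq_one`), `FukudaRankCountingLemmas` (`[Cl : Cl^p]` is a power of `p`).
-/

noncomputable section

open scoped NumberField
open NumberField MulAction

namespace Literature.NumberTheory.NumberFields

/-! ### §0 Arithmetic: `p ≡ −1 (mod ℓ)` turns `p^a ≡ p^b (mod ℓ)` into `a ≡ b (mod 2)` -/

/-- If `p ≡ −1 (mod ℓ)` with `ℓ > 2` and `p^a ≡ p^b (mod ℓ)`, then `a ≡ b (mod 2)` (`(−1)^a = (−1)^b` in `ℤ/ℓ`, where `−1 ≠ 1`).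
In particular (`ℓ = 3`, `p = 2`): `2^a ≡ 2^b (mod 3) ⟹ a ≡ b (mod 2)` — the order `f` of `p` modulo `ℓ` of Washington's Thm. 10.8 is `2`.
[cite: Washington1997, Thm. 10.8 (`f` = the order of `p` mod `n`)] -/
theorem modEq_two_of_pow_modEq_of_natCast_eq_neg_one {ℓ p a b : ℕ} (hℓ : 2 < ℓ) (hp : (p : ZMod ℓ) = -1)
    (h : p ^ a ≡ p ^ b [MOD ℓ]) : a ≡ b [MOD 2] := by
  haveI : Fact (2 < ℓ) := ⟨hℓ⟩
  have h' : ((p : ℕ) : ZMod ℓ) ^ a = ((p : ℕ) : ZMod ℓ) ^ b := by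
    have h1 := (ZMod.natCast_eq_natCast_iff _ _ _).mpr h
    push_cast at h1
    exact h1
  rw [hp, neg_one_pow_eq_pow_mod_two (R := ZMod ℓ) (n := a), neg_one_pow_eq_pow_mod_two (R := ZMod ℓ) (n := b)] at h'
  rcases Nat.mod_two_eq_zero_or_one a with ha | ha <;> rcases Nat.mod_two_eq_zero_or_one b with hb | hb
  · exact ha.trans hb.symm
  · exfalso
    rw [ha, hb, pow_zero, pow_one] at h'
    exact ZMod.neg_one_ne_one h'.symm
  · exfalso
    rw [ha, hb, pow_zero, pow_one] at h'
    exact ZMod.neg_one_ne_one h'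
  · exact ha.trans hb.symm

/-- `2 ≡ −1 (mod 3)`. [folklore] -/
private theorem natCast_two_eq_neg_one_zmod_three : ((2 : ℕ) : ZMod 3) = -1 := by decide

/-! ### §1 Counting in a finite commutative group -/

section Counting

variable {M : Type*} [CommGroup M] [Finite M]

/-- `#M[p^k] = p^{v_p #M}` for `k ≥ v_p #M` (`M` a finite commutative group): the `p^k`-torsion subgroup is then the Sylow `p`-subgroup
(the `p`-part `A` of the class group, `#A = p^{v_p h}`). [cite: Washington1997, §10.1 (the `p`-Sylow subgroup `A` of the class group)] -/
theorem natCard_torsion_pow_eq_pow_padicValNat {p : ℕ} [hp : Fact p.Prime] {k : ℕ} (hk : padicValNat p (Nat.card M) ≤ k) :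
    Nat.card {m : M // m ^ p ^ k = 1} = p ^ padicValNat p (Nat.card M) := by
  classical
  rw [← Nat.factorization_def _ hp.out] at hk ⊢
  obtain ⟨P⟩ : Nonempty (Sylow p M) := inferInstance
  have hP : Nat.card P = p ^ (Nat.card M).factorization p := P.card_eq_multiplicity
  let T : Subgroup M := (powMonoidHom (p ^ k) : M →* M).ker
  have hT : ∀ m, m ∈ T ↔ m ^ p ^ k = 1 := fun m => Iff.rfl
  have hcardT : Nat.card {m : M // m ^ p ^ k = 1} = Nat.card T :=
    Nat.card_congr (Equiv.subtypeEquivRight fun m => (hT m).symm)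
  have hPT : (P : Subgroup M) ≤ T := by
    intro x hx
    rw [hT, ← orderOf_dvd_iff_pow_eq_one]
    exact (Subgroup.orderOf_dvd_natCard (P : Subgroup M) hx).trans (hP ▸ pow_dvd_pow p hk)
  have hTp : IsPGroup p T := fun x => ⟨k, Subtype.ext ((hT x.1).mp x.2)⟩
  obtain ⟨n, hn⟩ := IsPGroup.iff_card.mp hTp
  have hdvd : p ^ n ∣ Nat.card M := hn ▸ Subgroup.card_subgroup_dvd_card T
  have hn_le : n ≤ (Nat.card M).factorization p :=
    (hp.out.pow_dvd_iff_le_factorization Nat.card_pos.ne').mp hdvd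
  have hle : Nat.card P ≤ Nat.card T := Subgroup.card_le_of_le hPT
  rw [hP, hn] at hle
  have hge : (Nat.card M).factorization p ≤ n := (Nat.pow_le_pow_iff_right hp.out.one_lt).mp hle
  rw [hcardT, hn, le_antisymm hn_le hge]

/-- `#M[q] = [M : M^q]` for a finite commutative group (`M[q] = ker (·)^q`, and `#ker · #range = #M = #range · [M : range]`). [folklore] -/
private theorem natCard_torsion_eq_index_range_powMonoidHom (q : ℕ) :
    Nat.card {m : M // m ^ q = 1} = (powMonoidHom q : M →* M).range.index := by
  have h0 : Nat.card {m : M // m ^ q = 1} = Nat.card (powMonoidHom q : M →* M).ker :=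
    Nat.card_congr (Equiv.subtypeEquivRight fun m => by rw [MonoidHom.mem_ker, powMonoidHom_apply])
  rw [h0]
  have h1 := Subgroup.card_mul_index (powMonoidHom q : M →* M).ker
  rw [Subgroup.index_ker] at h1
  have h2 := Subgroup.card_mul_index (powMonoidHom q : M →* M).range
  have hr : 0 < Nat.card (powMonoidHom q : M →* M).range := Nat.card_pos
  refine Nat.eq_of_mul_eq_mul_right hr ?_
  rw [h1, ← h2, mul_comm]

/-- The quotient `M / M^p` is killed by `p`, so `#(M / M^p)` is a power of `p`. [folklore] -/
private theorem exists_natCard_quotient_range_powMonoidHom_eq_pow (p : ℕ) [hp : Fact p.Prime] :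
    ∃ c : ℕ, Nat.card (M ⧸ (powMonoidHom p : M →* M).range) = p ^ c := by
  have hP : IsPGroup p (M ⧸ (powMonoidHom p : M →* M).range) := by
    intro x
    obtain ⟨m, rfl⟩ := QuotientGroup.mk_surjective x
    refine ⟨1, ?_⟩
    rw [pow_one, ← QuotientGroup.mk_pow, QuotientGroup.eq_one_iff]
    exact ⟨m, rfl⟩
  exact IsPGroup.iff_card.mp hP

/-- `#M[p] = p^{v_p #(M/M^p)}` (`= p^{rank_p M}`): both sides count `[M : M^p]`, a power of `p`. [folklore]
[cite: Washington1997, §13.3 (proof of Prop. 13.23: `#A[p] = #A/pA`)] -/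
theorem natCard_torsion_eq_pow_padicValNat_card_quotient (p : ℕ) [hp : Fact p.Prime] :
    Nat.card {m : M // m ^ p = 1} = p ^ padicValNat p (Nat.card (M ⧸ (powMonoidHom p : M →* M).range)) := by
  obtain ⟨c, hc⟩ := exists_natCard_quotient_range_powMonoidHom_eq_pow (M := M) p
  rw [natCard_torsion_eq_index_range_powMonoidHom, Subgroup.index_eq_card, hc, padicValNat.prime_pow]

/-- **Orbit counting.** A finite `ℓ`-group `G` acting on the finite commutative group `M` by automorphisms permutes the `q`-torsion
`M[q]`, and the number of its fixed points there is `≡ #M[q] (mod ℓ)` (non-trivial orbits have size divisible by `ℓ`).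
[folklore] [cite: Washington1997, §10.1] -/
theorem natCard_torsion_modEq_natCard_fixed_torsion {G : Type*} [Group G] [MulDistribMulAction G M] {ℓ : ℕ} [Fact ℓ.Prime]
    (hG : IsPGroup ℓ G) (q : ℕ) :
    Nat.card {m : M // m ^ q = 1} ≡ Nat.card {m : M // m ^ q = 1 ∧ ∀ g : G, g • m = m} [MOD ℓ] := by
  -- the action on the `q`-torsion
  let X := {m : M // m ^ q = 1}
  letI : MulAction G X :=
    { smul := fun g x => ⟨g • (x : M), by rw [← smul_pow', x.2, smul_one]⟩  -- `g • m^q = (g • m)^q`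
      one_smul := fun x => Subtype.ext (one_smul G (x : M))
      mul_smul := fun g h x => Subtype.ext (mul_smul g h (x : M)) }
  have hsmul : ∀ (g : G) (x : X), ((g • x : X) : M) = g • (x : M) := fun _ _ => rfl
  have hmod := hG.card_modEq_card_fixedPoints X
  have hfix : Nat.card (fixedPoints G X) = Nat.card {m : M // m ^ q = 1 ∧ ∀ g : G, g • m = m} :=
    Nat.card_congr
      { toFun := fun x => ⟨(x.1 : M), x.1.2, fun g => by
          have h := x.2 g
          exact congrArg Subtype.val h⟩
        invFun := fun m => ⟨⟨m.1, m.2.1⟩, fun g => Subtype.ext (m.2.2 g)⟩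
        left_inv := fun _ => rfl
        right_inv := fun _ => rfl }
  rwa [hfix] at hmod

end Counting

/-! ### §2 Number fields: `#Cl(L)[p^k]^G = #Cl(K)[p^k]` (`p ∤ [L:K]`) and the congruences modulo `ℓ` for an `ℓ`-group `G` -/

section NumberFields

variable (K L : Type) [Field K] [NumberField K] [Field L] [NumberField L] [Algebra K L] [IsGalois K L]

omit [IsGalois K L] in
/-- Extended classes are Galois-invariant: `σ • i_{L/K}(d) = i_{L/K}(d)` for `σ ∈ Gal(L/K)` (`σ` restricts to the identity of `K`;
tree `classGroupExtend_mulEquiv_intAut`). [cite: NeukirchANT1999, Ch. III §1 Prop. (1.6) (iv)] -/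
theorem mulEquiv_intAut_classGroupExtend (σ : L ≃ₐ[K] L) (d : ClassGroup (𝓞 K)) :
    ClassGroup.mulEquiv (AmbiguousClass.intAut σ) (classGroupExtend K L d) = classGroupExtend K L d := by
  have key := classGroupExtend_mulEquiv_intAut K L σ (1 : K ≃ₐ[K] K) (fun x => by rw [AlgEquiv.one_apply]; exact σ.commutes x) d
  rw [AmbiguousClass.mulEquiv_intAut_one, MulEquiv.refl_apply] at key
  exact key.symm

/-- **`#Cl(L)[p^k]^{Gal(L/K)} = #Cl(K)[p^k]` for `p ∤ [L : K]`**, every `k`: `d ↦ i_{L/K} d` injects the right side into the left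
(`N ∘ i = (·)^{[L:K]}` is injective on the `p`-power torsion, tree `classGroupExtend_injOn_pow_eq_one`) and `c ↦ N_{L/K} c` injects the left
side into the right (`i ∘ N = ∏_σ σ = (·)^{[L:K]}` on invariant classes, tree `classGroupExtend_classGroupNorm_eq_prod`, and
`gcd([L:K], p^k) = 1`).  The case `k = 1` over a fixed field is the tree's `natCard_fixed_torsion_classGroup_eq_natCard_torsion_classGroup_fixedField`.
[cite: NeukirchANT1999, Ch. III §1 Prop. (1.6) (ii), (iv)] [cite: Washington1997, §10.1] -/
theorem natCard_fixed_torsion_pow_classGroup_eq {p : ℕ} (hp : p.Prime) (hpn : ¬ p ∣ Module.finrank K L) (k : ℕ) :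
    Nat.card {c : ClassGroup (𝓞 L) // c ^ p ^ k = 1 ∧ ∀ σ : L ≃ₐ[K] L, ClassGroup.mulEquiv (AmbiguousClass.intAut σ) c = c} =
      Nat.card {d : ClassGroup (𝓞 K) // d ^ p ^ k = 1} := by
  classical
  haveI : FiniteDimensional K L := Module.Finite.of_restrictScalars_finite ℚ K L
  apply le_antisymm
  · -- `c ↦ N c`
    let Φ : {c : ClassGroup (𝓞 L) // c ^ p ^ k = 1 ∧ ∀ σ : L ≃ₐ[K] L, ClassGroup.mulEquiv (AmbiguousClass.intAut σ) c = c} →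
        {d : ClassGroup (𝓞 K) // d ^ p ^ k = 1} := fun c =>
      ⟨classGroupNorm K L c.1, by rw [← map_pow, c.2.1, map_one]⟩
    have key : ∀ c : ClassGroup (𝓞 L), (∀ σ : L ≃ₐ[K] L, ClassGroup.mulEquiv (AmbiguousClass.intAut σ) c = c) →
        classGroupExtend K L (classGroupNorm K L c) = c ^ Module.finrank K L := fun c hc =>
      (pow_finrank_eq_classGroupExtend_classGroupNorm_of_forall_smul_eq K L hc).symm
    have hg : Nat.gcd (Module.finrank K L) (p ^ k) = 1 :=
      Nat.Coprime.gcd_eq_one (Nat.Coprime.pow_right k (Nat.coprime_comm.mp ((Nat.Prime.coprime_iff_not_dvd hp).mpr hpn)))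
    have hΦ : Function.Injective Φ := by
      rintro ⟨c, hc, hcfix⟩ ⟨c', hc', hc'fix⟩ h
      apply Subtype.ext
      have h1 : classGroupNorm K L c = classGroupNorm K L c' := congrArg Subtype.val h
      have h2 : (c / c') ^ Module.finrank K L = 1 := by
        rw [div_pow, ← key c hcfix, ← key c' hc'fix, h1, div_self']
      have h3 : (c / c') ^ p ^ k = 1 := by rw [div_pow, hc, hc', div_one]
      have h4 : (c / c') ^ 1 = 1 := by
        rw [← hg]
        exact pow_gcd_eq_one.mpr ⟨h2, h3⟩
      rw [pow_one] at h4
      exact div_eq_one.mp h4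
    exact Nat.card_le_card_of_injective Φ hΦ
  · -- `d ↦ i d`
    let Ψ : {d : ClassGroup (𝓞 K) // d ^ p ^ k = 1} →
        {c : ClassGroup (𝓞 L) // c ^ p ^ k = 1 ∧ ∀ σ : L ≃ₐ[K] L, ClassGroup.mulEquiv (AmbiguousClass.intAut σ) c = c} := fun d =>
      ⟨classGroupExtend K L d.1, by rw [← map_pow, d.2, map_one], fun σ => mulEquiv_intAut_classGroupExtend K L σ d.1⟩
    have hΨ : Function.Injective Ψ := by
      rintro ⟨d, hd⟩ ⟨d', hd'⟩ hdd
      apply Subtype.ext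
      have h1 : classGroupExtend K L d = classGroupExtend K L d' := congrArg Subtype.val hdd
      exact classGroupExtend_injOn_pow_eq_one K L hp hpn ⟨k, hd⟩ ⟨k, hd'⟩ h1
    exact Nat.card_le_card_of_injective Ψ hΨ

/-- **`v_p h_K ≤ v_p h_L` for `p ∤ [L : K]`** (`L/K` Galois): `Cl(K)[p^k] ↪ Cl(L)[p^k]` for `k` large.
[cite: Washington1997, §10.1] [cite: NeukirchANT1999, Ch. III §1 Prop. (1.6) (ii)] -/
theorem padicValNat_card_classGroup_le_of_not_dvd_finrank {p : ℕ} [hp : Fact p.Prime] (hpn : ¬ p ∣ Module.finrank K L) :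
    padicValNat p (Nat.card (ClassGroup (𝓞 K))) ≤ padicValNat p (Nat.card (ClassGroup (𝓞 L))) := by
  set k := padicValNat p (Nat.card (ClassGroup (𝓞 K))) + padicValNat p (Nat.card (ClassGroup (𝓞 L))) with hk
  have h1 := natCard_torsion_pow_eq_pow_padicValNat (M := ClassGroup (𝓞 K)) (p := p) (k := k) (Nat.le_add_right _ _)
  have h2 := natCard_torsion_pow_eq_pow_padicValNat (M := ClassGroup (𝓞 L)) (p := p) (k := k) (Nat.le_add_left _ _)
  have h3 := natCard_fixed_torsion_pow_classGroup_eq K L hp.out hpn k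
  have hle : Nat.card {c : ClassGroup (𝓞 L) // c ^ p ^ k = 1 ∧ ∀ σ : L ≃ₐ[K] L, ClassGroup.mulEquiv (AmbiguousClass.intAut σ) c = c} ≤
      Nat.card {c : ClassGroup (𝓞 L) // c ^ p ^ k = 1} :=
    Nat.card_le_card_of_injective (fun c => ⟨c.1, c.2.1⟩) fun c c' h => Subtype.ext (Subtype.mk.inj h)
  rw [h3, h1, h2] at hle
  exact (Nat.pow_le_pow_iff_right hp.out.one_lt).mp hle

/-- **`rank_p Cl(K) ≤ rank_p Cl(L)` for `p ∤ [L : K]`** (`rank_p M = v_p #(M/M^p)`; `Cl(K)[p] ↪ Cl(L)[p]`).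
[cite: Washington1997, §10.1] [cite: NeukirchANT1999, Ch. III §1 Prop. (1.6) (ii)] -/
theorem padicValNat_card_quotient_pow_le_of_not_dvd_finrank {p : ℕ} [hp : Fact p.Prime] (hpn : ¬ p ∣ Module.finrank K L) :
    padicValNat p (Nat.card (ClassGroup (𝓞 K) ⧸ (powMonoidHom p : ClassGroup (𝓞 K) →* _).range)) ≤
      padicValNat p (Nat.card (ClassGroup (𝓞 L) ⧸ (powMonoidHom p : ClassGroup (𝓞 L) →* _).range)) := by
  have h1 := natCard_torsion_eq_pow_padicValNat_card_quotient (M := ClassGroup (𝓞 K)) p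
  have h2 := natCard_torsion_eq_pow_padicValNat_card_quotient (M := ClassGroup (𝓞 L)) p
  have h3 := natCard_fixed_torsion_pow_classGroup_eq K L hp.out hpn 1
  rw [pow_one] at h3
  have hle : Nat.card {c : ClassGroup (𝓞 L) // c ^ p = 1 ∧ ∀ σ : L ≃ₐ[K] L, ClassGroup.mulEquiv (AmbiguousClass.intAut σ) c = c} ≤
      Nat.card {c : ClassGroup (𝓞 L) // c ^ p = 1} :=
    Nat.card_le_card_of_injective (fun c => ⟨c.1, c.2.1⟩) fun c c' h => Subtype.ext (Subtype.mk.inj h)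
  rw [h3, h1, h2] at hle
  exact (Nat.pow_le_pow_iff_right hp.out.one_lt).mp hle

omit [NumberField K] [IsGalois K L] in
/-- The Galois action on ideal classes as a homomorphism `Gal(L/K) → Aut Cl(L)` (`σ ↦ ([I] ↦ [σ I])`; functoriality is the tree's
`AmbiguousClass.mulEquiv_intAut_one/_mul`). [folklore] -/
private theorem exists_monoidHom_mulAut_classGroup :
    ∃ φ : (L ≃ₐ[K] L) →* MulAut (ClassGroup (𝓞 L)), ∀ σ : L ≃ₐ[K] L, φ σ = ClassGroup.mulEquiv (AmbiguousClass.intAut σ) :=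
  ⟨MonoidHom.mk' (fun σ => ClassGroup.mulEquiv (AmbiguousClass.intAut σ)) fun σ τ => by
      rw [AmbiguousClass.mulEquiv_intAut_mul]; rfl, fun _ => rfl⟩

omit [NumberField K] [IsGalois K L] in
/-- **Orbit counting on `Cl(L)[q]`**: if `Gal(L/K)` is an `ℓ`-group, then for every `q`
`#Cl(L)[q] ≡ #{c ∈ Cl(L)[q] : σ c = c ∀ σ} (mod ℓ)`. [folklore] [cite: Washington1997, §10.1] -/
theorem natCard_torsion_classGroup_modEq_fixed {ℓ : ℕ} [Fact ℓ.Prime] (hG : IsPGroup ℓ (L ≃ₐ[K] L)) (q : ℕ) :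
    Nat.card {c : ClassGroup (𝓞 L) // c ^ q = 1} ≡
      Nat.card {c : ClassGroup (𝓞 L) // c ^ q = 1 ∧ ∀ σ : L ≃ₐ[K] L, ClassGroup.mulEquiv (AmbiguousClass.intAut σ) c = c} [MOD ℓ] := by
  obtain ⟨φ, hφ⟩ := exists_monoidHom_mulAut_classGroup K L
  letI : MulDistribMulAction (L ≃ₐ[K] L) (ClassGroup (𝓞 L)) := MulDistribMulAction.compHom _ φ
  have hsmul : ∀ (σ : L ≃ₐ[K] L) (c : ClassGroup (𝓞 L)), σ • c = ClassGroup.mulEquiv (AmbiguousClass.intAut σ) c := fun σ c => by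
    change φ σ c = _
    rw [hφ σ]
  have h := natCard_torsion_modEq_natCard_fixed_torsion (M := ClassGroup (𝓞 L)) hG q
  have e : Nat.card {c : ClassGroup (𝓞 L) // c ^ q = 1 ∧ ∀ σ : L ≃ₐ[K] L, σ • c = c} =
      Nat.card {c : ClassGroup (𝓞 L) // c ^ q = 1 ∧ ∀ σ : L ≃ₐ[K] L, ClassGroup.mulEquiv (AmbiguousClass.intAut σ) c = c} :=
    Nat.card_congr (Equiv.subtypeEquivRight fun c => by simp only [hsmul])
  rwa [e] at h

/-- In an `ℓ`-group Galois extension no prime `p ≠ ℓ` divides the degree (`[L:K] = #Gal(L/K) = ℓ^a`; the standing hypothesis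
`p ∤ [L:K]` of the coprime descent). [cite: Washington1997, §10.1 (`p ∤ [L:K]`)] -/
theorem not_dvd_finrank_of_isPGroup {ℓ p : ℕ} [Fact ℓ.Prime] [hp : Fact p.Prime] (hG : IsPGroup ℓ (L ≃ₐ[K] L)) (hpℓ : p ≠ ℓ) :
    ¬ p ∣ Module.finrank K L := by
  haveI : FiniteDimensional K L := Module.Finite.of_restrictScalars_finite ℚ K L
  obtain ⟨n, hn⟩ := IsPGroup.iff_card.mp hG
  rw [← IsGalois.card_aut_eq_finrank, hn]
  intro h
  exact hpℓ ((Nat.prime_dvd_prime_iff_eq hp.out Fact.out).mp (hp.out.dvd_of_dvd_pow h))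

/-- ★ **`p^{v_p h(L)} ≡ p^{v_p h(K)} (mod ℓ)`** for a Galois extension `L/K` whose group is an `ℓ`-group and a prime `p ≠ ℓ`: both sides count
`p^k`-torsion classes (`k ≫ 0`), of `L` resp. — through `#Cl(L)[p^k]^G = #Cl(K)[p^k]` — the `G`-fixed ones, and these counts are congruent
modulo `ℓ` by orbit counting.  Equivalently `v_p h(L) − v_p h(K)` is a non-negative multiple of the order of `p` modulo `ℓ`.
[cite: Washington1997, §10.1 and Thm. 10.8] [cite: NeukirchANT1999, Ch. III §1 Prop. (1.6) (ii), (iv)] -/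
theorem pow_padicValNat_card_classGroup_modEq {ℓ p : ℕ} [Fact ℓ.Prime] [hp : Fact p.Prime] (hG : IsPGroup ℓ (L ≃ₐ[K] L)) (hpℓ : p ≠ ℓ) :
    p ^ padicValNat p (Nat.card (ClassGroup (𝓞 L))) ≡ p ^ padicValNat p (Nat.card (ClassGroup (𝓞 K))) [MOD ℓ] := by
  have hpn := not_dvd_finrank_of_isPGroup K L hG hpℓ
  set k := padicValNat p (Nat.card (ClassGroup (𝓞 K))) + padicValNat p (Nat.card (ClassGroup (𝓞 L))) with hk
  have h1 := natCard_torsion_pow_eq_pow_padicValNat (M := ClassGroup (𝓞 K)) (p := p) (k := k) (Nat.le_add_right _ _)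
  have h2 := natCard_torsion_pow_eq_pow_padicValNat (M := ClassGroup (𝓞 L)) (p := p) (k := k) (Nat.le_add_left _ _)
  have h3 := natCard_fixed_torsion_pow_classGroup_eq K L hp.out hpn k
  have h4 := natCard_torsion_classGroup_modEq_fixed K L hG (p ^ k)
  rwa [h3, h1, h2] at h4

/-- ★ **`p^{rank_p Cl(L)} ≡ p^{rank_p Cl(K)} (mod ℓ)`** (`rank_p M = v_p #(M/M^p) = dim_{𝔽_p} M[p]`) for `Gal(L/K)` an `ℓ`-group, `p ≠ ℓ`:
orbit counting on `Cl(L)[p]` and `#Cl(L)[p]^G = #Cl(K)[p]`.  Equivalently `rank_p Cl(L) − rank_p Cl(K)` is a non-negative multiple of the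
order of `p` modulo `ℓ` (Washington Thm. 10.8: «the `p`-rank of `A` is a multiple of `f`», there for `p ∤ h` of the subfields).
[cite: Washington1997, Thm. 10.8] [cite: NeukirchANT1999, Ch. III §1 Prop. (1.6) (ii), (iv)] -/
theorem pow_padicValNat_card_quotient_pow_modEq {ℓ p : ℕ} [Fact ℓ.Prime] [hp : Fact p.Prime] (hG : IsPGroup ℓ (L ≃ₐ[K] L))
    (hpℓ : p ≠ ℓ) :
    p ^ padicValNat p (Nat.card (ClassGroup (𝓞 L) ⧸ (powMonoidHom p : ClassGroup (𝓞 L) →* _).range)) ≡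
      p ^ padicValNat p (Nat.card (ClassGroup (𝓞 K) ⧸ (powMonoidHom p : ClassGroup (𝓞 K) →* _).range)) [MOD ℓ] := by
  have hpn := not_dvd_finrank_of_isPGroup K L hG hpℓ
  have h1 := natCard_torsion_eq_pow_padicValNat_card_quotient (M := ClassGroup (𝓞 K)) p
  have h2 := natCard_torsion_eq_pow_padicValNat_card_quotient (M := ClassGroup (𝓞 L)) p
  have h3 := natCard_fixed_torsion_pow_classGroup_eq K L hp.out hpn 1
  rw [pow_one] at h3
  have h4 := natCard_torsion_classGroup_modEq_fixed K L hG p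
  rwa [h3, h1, h2] at h4

/-! ### §3 Parity: `p ≡ −1 (mod ℓ)`, and the cubic case `ℓ = 3`, `p = 2` -/

/-- **`v_p h(L) ≡ v_p h(K) (mod 2)`** when `Gal(L/K)` is an `ℓ`-group, `ℓ > 2`, and `p ≡ −1 (mod ℓ)`.
[cite: Washington1997, §10.1 and Thm. 10.8] -/
theorem padicValNat_card_classGroup_modEq_two {ℓ p : ℕ} [Fact ℓ.Prime] [Fact p.Prime] (hG : IsPGroup ℓ (L ≃ₐ[K] L))
    (hℓ : 2 < ℓ) (hp : (p : ZMod ℓ) = -1) :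
    padicValNat p (Nat.card (ClassGroup (𝓞 L))) ≡ padicValNat p (Nat.card (ClassGroup (𝓞 K))) [MOD 2] := by
  have hpℓ : p ≠ ℓ := by
    rintro rfl
    rw [ZMod.natCast_self, zero_eq_neg] at hp
    exact one_ne_zero hp
  exact modEq_two_of_pow_modEq_of_natCast_eq_neg_one hℓ hp (pow_padicValNat_card_classGroup_modEq K L hG hpℓ)

/-- **`rank_p Cl(L) ≡ rank_p Cl(K) (mod 2)`** when `Gal(L/K)` is an `ℓ`-group, `ℓ > 2`, and `p ≡ −1 (mod ℓ)`. [cite: Washington1997, Thm. 10.8] -/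
theorem padicValNat_card_quotient_pow_modEq_two {ℓ p : ℕ} [Fact ℓ.Prime] [Fact p.Prime] (hG : IsPGroup ℓ (L ≃ₐ[K] L))
    (hℓ : 2 < ℓ) (hp : (p : ZMod ℓ) = -1) :
    padicValNat p (Nat.card (ClassGroup (𝓞 L) ⧸ (powMonoidHom p : ClassGroup (𝓞 L) →* _).range)) ≡
      padicValNat p (Nat.card (ClassGroup (𝓞 K) ⧸ (powMonoidHom p : ClassGroup (𝓞 K) →* _).range)) [MOD 2] := by
  have hpℓ : p ≠ ℓ := by
    rintro rfl
    rw [ZMod.natCast_self, zero_eq_neg] at hp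
    exact one_ne_zero hp
  exact modEq_two_of_pow_modEq_of_natCast_eq_neg_one hℓ hp (pow_padicValNat_card_quotient_pow_modEq K L hG hpℓ)

/-- A Galois extension of degree dividing `3` has a `3`-group (of order `1` or `3`) as Galois group (the cyclic cubic case of Washington's
Thm. 10.8, `n = 3`). [cite: Washington1997, Thm. 10.8 (the case `n = 3`)] -/
theorem isPGroup_three_of_finrank_dvd_three (h3 : Module.finrank K L ∣ 3) : IsPGroup 3 (L ≃ₐ[K] L) := by
  haveI : FiniteDimensional K L := Module.Finite.of_restrictScalars_finite ℚ K L
  haveI : Fact (Nat.Prime 3) := ⟨Nat.prime_three⟩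
  have hcard : Nat.card (L ≃ₐ[K] L) ∣ 3 := by rw [IsGalois.card_aut_eq_finrank]; exact h3
  rcases (Nat.dvd_prime Nat.prime_three).mp hcard with h | h
  · exact IsPGroup.of_card (n := 0) (by rw [h, pow_zero])
  · exact IsPGroup.of_card (n := 1) (by rw [h, pow_one])

/-- ★ **THE CUBIC PARITY LAW for class numbers: `ord₂ h(L) ≡ ord₂ h(K) (mod 2)`** for every Galois extension `L/K` of number fields of
degree dividing `3` (`2 ≡ −1 (mod 3)`): the `2`-part of `h(L)/h(K)` is a power of `4`. [cite: Washington1997, §10.1 and Thm. 10.8] -/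
theorem padicValNat_two_card_classGroup_modEq_two_of_finrank_dvd_three (h3 : Module.finrank K L ∣ 3) :
    padicValNat 2 (Nat.card (ClassGroup (𝓞 L))) ≡ padicValNat 2 (Nat.card (ClassGroup (𝓞 K))) [MOD 2] := by
  haveI : Fact (Nat.Prime 3) := ⟨Nat.prime_three⟩
  haveI : Fact (Nat.Prime 2) := ⟨Nat.prime_two⟩
  exact padicValNat_card_classGroup_modEq_two K L (isPGroup_three_of_finrank_dvd_three K L h3) (by norm_num)
    natCast_two_eq_neg_one_zmod_three

/-- ★ **THE CUBIC PARITY LAW for `2`-ranks: `rank₂ Cl(L) ≡ rank₂ Cl(K) (mod 2)`** for every Galois extension `L/K` of number fields of degree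
dividing `3`. [cite: Washington1997, Thm. 10.8] -/
theorem padicValNat_two_card_quotient_sq_modEq_two_of_finrank_dvd_three (h3 : Module.finrank K L ∣ 3) :
    padicValNat 2 (Nat.card (ClassGroup (𝓞 L) ⧸ (powMonoidHom 2 : ClassGroup (𝓞 L) →* _).range)) ≡
      padicValNat 2 (Nat.card (ClassGroup (𝓞 K) ⧸ (powMonoidHom 2 : ClassGroup (𝓞 K) →* _).range)) [MOD 2] := by
  haveI : Fact (Nat.Prime 3) := ⟨Nat.prime_three⟩
  haveI : Fact (Nat.Prime 2) := ⟨Nat.prime_two⟩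
  exact padicValNat_card_quotient_pow_modEq_two K L (isPGroup_three_of_finrank_dvd_three K L h3) (by norm_num)
    natCast_two_eq_neg_one_zmod_three

/-- The class-number form: `ord₂ h(K) ≤ ord₂ h(L)` and `ord₂ h(L) − ord₂ h(K)` is EVEN, for `L/K` Galois of degree dividing `3`
(`h = NumberField.classNumber`). [cite: Washington1997, §10.1 and Thm. 10.8] -/
theorem padicValNat_two_classNumber_le_and_even_sub_of_finrank_dvd_three (h3 : Module.finrank K L ∣ 3) :
    padicValNat 2 (classNumber K) ≤ padicValNat 2 (classNumber L) ∧
      Even (padicValNat 2 (classNumber L) - padicValNat 2 (classNumber K)) := by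
  haveI : Fact (Nat.Prime 2) := ⟨Nat.prime_two⟩
  haveI : Fact (Nat.Prime 3) := ⟨Nat.prime_three⟩
  have hpn : ¬ 2 ∣ Module.finrank K L := not_dvd_finrank_of_isPGroup K L (isPGroup_three_of_finrank_dvd_three K L h3) (by norm_num)
  have hle := padicValNat_card_classGroup_le_of_not_dvd_finrank K L (p := 2) hpn
  have hmod := padicValNat_two_card_classGroup_modEq_two_of_finrank_dvd_three K L h3
  rw [classNumber, classNumber, ← Nat.card_eq_fintype_card, ← Nat.card_eq_fintype_card]
  exact ⟨hle, even_iff_two_dvd.mpr ((Nat.modEq_iff_dvd' hle).mp hmod.symm)⟩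

end NumberFields

end Literature.NumberTheory.NumberFields

end
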